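import Summits.HubbardSuperconductivity.HubbardSuperconductivity.Theorems.AnisotropyChordThermalChordEndpoints

/-!
# Route `AnisotropyChord`, crux `ChordXY` (stmt-HubbardSuperconductivity-8146), line `condensate-slab`:
# the skeleton's statement abbreviations `slabVec`, `slabCondensate` (landed verbatim)

The crux-plan skeleton `Cruxes/ChordXY/Lines/condensate_slab.lean` (sha `58249b29…`; composition
`ChordXY_of : Theses.AnisotropyChord.ChordXY` kernel-checked modulo `stub_slabConcave_smallBeta`,
`stub_slabConcavity_propagates`, `stub_slabGroundStateLimit`) states its stubs through two local
abbreviations, landed here VERBATIM (namespace `…Theorems.AnisotropyChord.CondensateSlab`) so that the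
line's stubs can be closed BY NAME in `Theorems/` and the lead skeleton imports them instead of
re-declaring (the same device as `…ThermalCondensateDefs` / `…DoobJohnsonChordDefs`):

* `slabVec M β Δ` — the SLAB VECTOR `v_β(Δ) = e^{-β H_M(Δ)} P₀ 𝟙`: imaginary-time evolution
  (`Matrix.gibbsWeight`) of the `S^z_tot = 0` component (`sectorProj M`) of the all-ones vector `𝟙` of
  the `S^z`-basis (the sector component of the fully `x`-polarised state),
  `H_M(Δ) = xxzHamiltonian 1 (torusGraph 2 M) (-1) Δ`;
* `slabCondensate M β Δ` — the SLAB CONDENSATE `Λˢ_{β,M}(Δ) = Re(⟨v_β, S⁺_tot S⁻_tot v_β⟩ / ⟨v_β, v_β⟩)`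
  (a Rayleigh quotient of `condensateOp M`, junk value `0` if `v_β = 0`);

with unfolding lemmas (`rfl`) and the elementary `slabCondensate_nonneg` (`Λˢ ≥ 0`, from
`condensateOp_posSemidef`).  Sources: Kennedy–Lieb–Shastry, J. Stat. Phys. 53 (1988) (the condensate
observable); O. Bratteli, D. W. Robinson, *Operator Algebras and Quantum Statistical Mechanics II*
§5.3.1 (`e^{-βH}`); H. Tasaki (2020) App. A.2 (sector projection).  The definitions are statement
abbreviations (no mathematical content).  HONEST: nothing here proves `ChordXY`; superconductivity
in the Hubbard model is not advanced.
-/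

set_option linter.dupNamespace false

noncomputable section

open scoped ComplexOrder

namespace Summit.HubbardSuperconductivity.HubbardSuperconductivity.Theorems.AnisotropyChord.CondensateSlab

open Matrix
open Literature.MathematicalPhysics.QuantumLattice Literature.Probability.LatticeModels
open Summit.HubbardSuperconductivity.HubbardSuperconductivity.Theorems.AnisotropyChord

/-- The SLAB VECTOR `v_β(Δ) = e^{-β H_M(Δ)} P₀ 𝟙`: imaginary-time evolution, for time `β`, of the sector
component of the fully `x`-polarised state — verbatim the skeleton's `slabVec`.
Bratteli–Robinson II §5.3.1. [statement abbreviation] -/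
def slabVec (M : ℕ) [NeZero M] (β Δ : ℝ) : TensorIndex (TorusSite 2 M) 2 → ℂ :=
  gibbsWeight β (xxzHamiltonian 1 (torusGraph 2 M) (-1) Δ) *ᵥ (sectorProj M *ᵥ fun _ => 1)

/-- The SLAB CONDENSATE `Λˢ_{β,M}(Δ) = Re(⟨v_β, S⁺_tot S⁻_tot v_β⟩ / ⟨v_β, v_β⟩)` (junk value `0` if
`v_β = 0`, which does not happen for even `M ≥ 2`) — verbatim the skeleton's `slabCondensate`.
Kennedy–Lieb–Shastry (1988). [statement abbreviation] -/
def slabCondensate (M : ℕ) [NeZero M] (β Δ : ℝ) : ℝ :=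
  ((star (slabVec M β Δ) ⬝ᵥ (condensateOp M *ᵥ slabVec M β Δ)) /
    (star (slabVec M β Δ) ⬝ᵥ slabVec M β Δ)).re

/-- Unfolding lemma for `slabVec`. [bookkeeping] -/
theorem slabVec_eq (M : ℕ) [NeZero M] (β Δ : ℝ) :
    slabVec M β Δ =
      gibbsWeight β (xxzHamiltonian 1 (torusGraph 2 M) (-1) Δ) *ᵥ (sectorProj M *ᵥ fun _ => 1) :=
  rfl

/-- Unfolding lemma for `slabCondensate`. [bookkeeping] -/
theorem slabCondensate_eq (M : ℕ) [NeZero M] (β Δ : ℝ) :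
    slabCondensate M β Δ =
      ((star (slabVec M β Δ) ⬝ᵥ (condensateOp M *ᵥ slabVec M β Δ)) /
        (star (slabVec M β Δ) ⬝ᵥ slabVec M β Δ)).re :=
  rfl

/-- **The slab condensate is nonnegative**: `Λˢ_{β,M}(Δ) ≥ 0` for every `M`, `β`, `Δ` (numerator
`⟨v, S⁺S⁻ v⟩ ≥ 0` since `S⁺_tot S⁻_tot = B Bᴴ`, denominator `⟨v, v⟩ ≥ 0` real; junk value `x/0 = 0`
covers `v = 0`) — verbatim the skeleton's proved lemma. [folklore] -/
theorem slabCondensate_nonneg (M : ℕ) [NeZero M] (β Δ : ℝ) : 0 ≤ slabCondensate M β Δ := by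
  unfold slabCondensate
  obtain ⟨hn_re, hn_im⟩ := Complex.nonneg_iff.mp
    ((condensateOp_posSemidef M).dotProduct_mulVec_nonneg (slabVec M β Δ))
  obtain ⟨hd_re, hd_im⟩ := Complex.nonneg_iff.mp (dotProduct_star_self_nonneg (slabVec M β Δ))
  rw [Complex.div_re, ← hn_im, zero_mul, zero_div, add_zero]
  exact div_nonneg (mul_nonneg hn_re hd_re) (Complex.normSq_nonneg _)

end Summit.HubbardSuperconductivity.HubbardSuperconductivity.Theorems.AnisotropyChord.CondensateSlab

end
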